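/-
Origin: expansion seat `planner-pub-hodgecm-toy2-g2-0`, handover 2026-08-18 (`HOME/pub-hodgecm-toy2-g2/lean/Toy2g2/Octic.lean`, md5 9db1c779, 126 lines);
landed by the gen-6 packager in gate run 22 as `HodgeCM/Model/SexticCM/Octic.lean` (import ^import Toy2g2\.→import HodgeCM.Model.SexticCM. ×1).
-/
/-
Copyright: pub-hodgecm formalisation cell (harness21, 2026). New file (not vendored).
Origin: HOME/pub-hodgecm-toy2-g2/lean/Toy2g2/Octic.lean (WIP module `Toy2g2.Octic`; intended final place
`HodgeCM/Model/SexticCM/Octic.lean` = module `HodgeCM.Model.SexticCM.Octic`, CONTRIBUTING §3 L5) (seat planner-pub-hodgecm-toy2-g2-0,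
consistency seat 2 gen 2, part (6a)(ii): PerL's hypotheses are inhabited — irreducibility over Q of m_eps = X^8+24X^6+152X^4+160X^2+16 (two-prime certificate 3, 7)).
-/
import Summits.HodgeConjecture.HodgeCM.Model.SexticCM.Fp

/-!
# Irreducibility of the octic `m_ε = X⁸ + 24X⁶ + 152X⁴ + 160X² + 16` over `ℚ`

Two-prime pattern certificate: modulo 3, `m_ε ≡ S₃ · (X²+1)` with `S₃` an irreducible sextic, so a monic
factor of `m_ε` over `ℤ` of degree `1 ≤ k ≤ 4` has `k ≤ 2`; modulo 7, `m_ε ≡ A₇ · B₇` with `A₇ ≠ B₇` irreducible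
quartics, so such a factor has `k = 0`.  Hence `m_ε` is irreducible over `ℤ`, and by Gauss over `ℚ`.
-/

open Polynomial

namespace HodgeCM.SexticCM

open Fp

noncomputable section

/-- `m_ε` over `ℤ` -/
def mεℤ : ℤ[X] := X ^ 8 + 24 * X ^ 6 + 152 * X ^ 4 + 160 * X ^ 2 + 16

/-- `m_ε` over `ℚ` -/
def mε : ℚ[X] := X ^ 8 + 24 * X ^ 6 + 152 * X ^ 4 + 160 * X ^ 2 + 16

/-- (Ported verbatim from the HodgeCMPerL package; no docstring in the source.) -/
lemma mε_map : mεℤ.map (Int.castRingHom ℚ) = mε := by simp [mεℤ, mε]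

/-- (Ported verbatim from the HodgeCMPerL package; no docstring in the source.) -/
lemma mεℤ_monic : mεℤ.Monic := by unfold mεℤ; monicity!

/-- (Ported verbatim from the HodgeCMPerL package; no docstring in the source.) -/
lemma mε_monic : mε.Monic := by unfold mε; monicity!

/-- (Ported verbatim from the HodgeCMPerL package; no docstring in the source.) -/
lemma mεℤ_natDegree : mεℤ.natDegree = 8 := by unfold mεℤ; compute_degree!

/-- (Ported verbatim from the HodgeCMPerL package; no docstring in the source.) -/
lemma mε_natDegree : mε.natDegree = 8 := by unfold mε; compute_degree!

/-! ### reductions mod 3 and mod 7 -/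

/-- (Ported verbatim from the HodgeCMPerL package; no docstring in the source.) -/
lemma S3_eq : S3 = X ^ 6 + 2 * X ^ 4 + 1 := by
  simp [S3, C_ofNat]

/-- (Ported verbatim from the HodgeCMPerL package; no docstring in the source.) -/
lemma A7_eq : A7 = X ^ 4 + 5 * X ^ 3 + X + 4 := by
  simp [A7, C_ofNat]

/-- (Ported verbatim from the HodgeCMPerL package; no docstring in the source.) -/
lemma B7_eq : B7 = X ^ 4 + 2 * X ^ 3 + 6 * X + 4 := by
  simp [B7, C_ofNat]

/-- (Ported verbatim from the HodgeCMPerL package; no docstring in the source.) -/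
lemma map3 : mεℤ.map (Int.castRingHom (ZMod 3)) = S3 * (X ^ 2 + 1) := by
  have h3 : (3 : (ZMod 3)[X]) = 0 := by
    have : ((3 : ℕ) : (ZMod 3)[X]) = 0 := CharP.cast_eq_zero _ 3
    simpa using this
  have : mεℤ = (X ^ 6 + 2 * X ^ 4 + 1) * (X ^ 2 + 1) + 3 * (7 * X ^ 6 + 50 * X ^ 4 + 53 * X ^ 2 + 5) := by
    unfold mεℤ; ring
  rw [this, S3_eq]; simp [h3]

/-- (Ported verbatim from the HodgeCMPerL package; no docstring in the source.) -/
lemma map7 : mεℤ.map (Int.castRingHom (ZMod 7)) = A7 * B7 := by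
  have h7 : (7 : (ZMod 7)[X]) = 0 := by
    have : ((7 : ℕ) : (ZMod 7)[X]) = 0 := CharP.cast_eq_zero _ 7
    simpa using this
  have : mεℤ = (X ^ 4 + 5 * X ^ 3 + X + 4) * (X ^ 4 + 2 * X ^ 3 + 6 * X + 4)
      + 7 * (-X ^ 7 + 2 * X ^ 6 - X ^ 5 + 16 * X ^ 4 - 4 * X ^ 3 + 22 * X ^ 2 - 4 * X) := by
    unfold mεℤ; ring
  rw [this, A7_eq, B7_eq]; simp [h7]

/-- (Ported verbatim from the HodgeCMPerL package; no docstring in the source.) -/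
lemma not_A7_dvd_B7 : ¬ A7 ∣ B7 := fun h =>
  A7_ne_B7 (eq_of_monic_of_dvd_of_natDegree_le A7_monic B7_monic h
    (by rw [A7_natDegree, B7_natDegree])).symm

/-- (Ported verbatim from the HodgeCMPerL package; no docstring in the source.) -/
lemma isCoprime_A7_B7 : IsCoprime A7 B7 :=
  (A7_irreducible.coprime_iff_not_dvd).mpr not_A7_dvd_B7

/-! ### irreducibility over `ℤ` and `ℚ` -/

/-- (Ported verbatim from the HodgeCMPerL package; no docstring in the source.) -/
theorem mεℤ_irreducible : Irreducible mεℤ := by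
  rw [mεℤ_monic.irreducible_iff_natDegree']
  refine ⟨fun h => ?_, fun f g hf hg hfg => ?_⟩
  · have := congrArg natDegree h; rw [mεℤ_natDegree] at this; simp at this
  · rw [mεℤ_natDegree, Finset.mem_Ioc]
    rintro ⟨h0, h4⟩
    have hsum : f.natDegree + g.natDegree = 8 := by rw [← hf.natDegree_mul hg, hfg, mεℤ_natDegree]
    -- mod 3
    have hk2 : g.natDegree ≤ 2 := by
      let f₃ := f.map (Int.castRingHom (ZMod 3))
      let g₃ := g.map (Int.castRingHom (ZMod 3))
      have hprod : f₃ * g₃ = S3 * (X ^ 2 + 1) := by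
        rw [← map3, ← hfg, Polynomial.map_mul]
      have hS : S3 ∣ f₃ * g₃ := hprod ▸ dvd_mul_right _ _
      rcases (S3_irreducible.prime.dvd_or_dvd hS) with h | h
      · have := natDegree_le_of_dvd h (hf.map _).ne_zero
        rw [S3_natDegree, hf.natDegree_map] at this
        omega
      · have := natDegree_le_of_dvd h (hg.map _).ne_zero
        rw [S3_natDegree, hg.natDegree_map] at this
        omega
    -- mod 7
    let f₇ := f.map (Int.castRingHom (ZMod 7))
    let g₇ := g.map (Int.castRingHom (ZMod 7))
    have hprod : f₇ * g₇ = A7 * B7 := by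
      rw [← map7, ← hfg, Polynomial.map_mul]
    have hA : A7 ∣ f₇ := by
      rcases A7_irreducible.prime.dvd_or_dvd (hprod ▸ dvd_mul_right A7 B7 : A7 ∣ f₇ * g₇) with h | h
      · exact h
      · have := natDegree_le_of_dvd h (hg.map _).ne_zero
        rw [A7_natDegree, hg.natDegree_map] at this
        omega
    have hB : B7 ∣ f₇ := by
      rcases B7_irreducible.prime.dvd_or_dvd (hprod ▸ dvd_mul_left B7 A7 : B7 ∣ f₇ * g₇) with h | h
      · exact h
      · have := natDegree_le_of_dvd h (hg.map _).ne_zero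
        rw [B7_natDegree, hg.natDegree_map] at this
        omega
    have hAB := natDegree_le_of_dvd (isCoprime_A7_B7.mul_dvd hA hB) (hf.map _).ne_zero
    rw [A7_monic.natDegree_mul B7_monic, A7_natDegree, B7_natDegree, hf.natDegree_map] at hAB
    omega

/-- (Ported verbatim from the HodgeCMPerL package; no docstring in the source.) -/
theorem mε_irreducible : Irreducible mε := by
  rw [← mε_map, ← IsPrimitive.Int.irreducible_iff_irreducible_map_cast mεℤ_monic.isPrimitive]
  exact mεℤ_irreducible

end

end HodgeCM.SexticCM
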